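import Summits.BirchSwinnertonDyer.BirchSwinnertonDyer.Theorems.EisensteinPrimesGoodLatticeHeckeCharOfTeichmuller
import Summits.BirchSwinnertonDyer.BirchSwinnertonDyer.Theorems.EisensteinPrimesTwoVariableKatzBranchSupply
import Literature.NumberTheory.EllipticCurves.Hida2010MuInvariant.AnticyclotomicKatzBranchMuInvariant
import Literature.NumberTheory.GaloisRepresentations.WeakAbelianDirectSummandCyclotomicProofs
import Literature.NumberTheory.GaloisRepresentations.ModPGaloisRepCyclotomicProofs
import Literature.NumberTheory.GaloisRepresentations.LocalKroneckerWeberInertiaProofs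
import Literature.NumberTheory.EllipticCurves.Kato2004.SemilocalDecompositionProofs
import HarnessLib

/-!
# The characters of the ω-branch: `Ω_K` (base change of `ω = θ_sub θ_quot`), `φ_K` with
# `φ_K ψ_K = Ω_K`, and the twisting character `η = Ω_K‖·‖` with `p`-adic avatar `⟨χ_p⟩`
# (Hecke-side bookkeeping of road R-ψ for [BRω]; helper for crux 2 `GoodLatticeBDPValue`,
# stmt-BirchSwinnertonDyer-19032, cell `bsd-eis` seat `bsd-eis-k5-c2`)

HOME/k5-ty-g8/BR-OMEGA-ROAD.md §2 (a)–(c) / HOME/k5-c2-MEMO-6.md ADDENDUM (3): for the residual pair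
`(θ_sub, θ_quot) = (ω̃, 𝟙̃)` of the good lattice, `φψ = ω`, the twist `η := φ_K ψ_K ‖·‖` has avatar `⟨χ_cyc⟩`,
and `φ_K⁻¹ η = ψ_K‖·‖ = (ψ_K⁻¹)̌ ` is the reflected branch character of `ψ`. This file does the Hecke-side
bookkeeping from the determinant identity (K-det) (`entry_mul_entry_eq_teichmullerChar`, here a hypothesis
`hdet`): `exists_unitsCharCl_entry` / `exists_framed_entry_mul` (rank-one plumbing, existence form);
`isPAdicAvatarOf_inv_of_isHeckeCharOf` (for `θ` unramified at every `w ∤ p` the geometric avatar of its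
arithmetic Hecke character is `θ⁻¹` — no gap, since `IsHeckeCharOf` is only used where `θ` is
unramified); `isPAdicAvatarOf_normCharacter` (`‖·‖ ↦ χ_p`); **`exists_omegaBranchCharacters`** — Hecke
characters `φ_K` (Artin, for `θ_sub|_K`), `η` and a continuous `r_η : Γ_K →ₜ* ℚ̄_pˣ` with
`IsHeckeCharOf ι θ_sub|_K φ_K`, `φ_K⁻¹ η = reflect ψ_K⁻¹`, `η` unramified off `p`, `IsPAdicAvatarOf ι η (e∘r_η)`,
`r_η(σ) = ⟨χ_p(σ)⟩` (the formula of `…TwoVariableCyclotomicUnitLine`), and `φ_K` ramified at `w ∤ p` iff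
`ψ_K` is; the identity `φ_K ψ_K = Ω_K` (Artin character of `ω|_K`) is Hecke rigidity
(`HeckeCharacter.ext_of_eventually_valueAtUniformizer_eq`). HONEST FRAMING: unconditional bookkeeping
(Artin reciprocity for characters is the tree's PROVED `artinReciprocity_character_holds`); no fact, no
definition, no `sorry`; closes nothing by itself. References: de Shalit 1987 II.6.1 (1); Cassels–Fröhlich
VII §4 Prop. 4.1, §5.1; Serre 1968 Ch. I §1.2, §2.1; CGLS 2022 (2.16); Keller–Yin 2024 §1.1, Thm. 1.2.2.
-/

-- the summit namespace `Summit.BirchSwinnertonDyer.BirchSwinnertonDyer` repeats the problem name by design (D-0017)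
set_option linter.dupNamespace false
set_option autoImplicit false

noncomputable section

open scoped Classical Topology

open Filter NumberField IsDedekindDomain Field Polynomial Literature.NumberTheory.EllipticCurves
  Literature.NumberTheory.GaloisRepresentations Literature.NumberTheory.GaloisRepresentations.HeckeCharacter
  Literature.NumberTheory.EllipticCurves.KellerYin2024 Literature.NumberTheory.EllipticCurves.Hida2010MuInvariant
  Summit.BirchSwinnertonDyer.Rank1Residual.X11b Summit.BirchSwinnertonDyer.Rank1Residual.X11b.Three.LambdaSupply
  Summit.BirchSwinnertonDyer.BirchSwinnertonDyer.Theorems.EisensteinPrimesMuLambda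

namespace Summit.BirchSwinnertonDyer.BirchSwinnertonDyer.Theorems.IwasawaTwoVariable

/-! ## §1 Rank-one plumbing: `𝓞`-valued framed characters as characters `Γ_K →ₜ* ℚ̄_pˣ` -/

section Plumbing

variable {K : Type} [Field K] {p : ℕ} [Fact p.Prime] (S₀ : Set (PadicAlgCl p))

/-- An `𝓞`-valued rank-one framed representation `θ` IS a continuous character `ψ : Γ_K →ₜ* ℚ̄_pˣ` with
`ψ(σ) = θ(σ)₀₀` (through `GL₁(𝓞) ≅ 𝓞ˣ ⊂ ℚ̄_pˣ`). Existence form (no definition). [folklore] -/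
theorem exists_unitsCharCl_entry (θ : FramedGaloisRep K (padicCoeffIntegers S₀) 1) :
    ∃ ψ : absoluteGaloisGroup K →ₜ* (PadicAlgCl p)ˣ, ∀ σ : absoluteGaloisGroup K,
      ((ψ σ : (PadicAlgCl p)ˣ) : PadicAlgCl p) = ((entry S₀ θ σ : padicCoeffIntegers S₀) : PadicAlgCl p) := by
  let e𝓞 := FramedRep.unitsContinuousMulEquivOfUnique (Fin 1) (padicCoeffIntegers S₀)
  let f : absoluteGaloisGroup K →* (PadicAlgCl p)ˣ :=
    ((Units.map (padicCoeffIntegers S₀).subtype.toMonoidHom).comp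
      (e𝓞.symm : GL (Fin 1) (padicCoeffIntegers S₀) →ₜ* (padicCoeffIntegers S₀)ˣ).toMonoidHom).comp
      θ.toMonoidHom
  have hfc : Continuous f :=
    ((Continuous.units_map _ continuous_subtype_val).comp
      (e𝓞.symm : GL (Fin 1) (padicCoeffIntegers S₀) →ₜ* (padicCoeffIntegers S₀)ˣ).continuous).comp
      θ.continuous
  refine ⟨{ toMonoidHom := f, continuous_toFun := hfc }, fun σ ↦ ?_⟩
  -- `(e𝓞.symm (θ σ) : 𝓞) = (θ σ)₀₀`
  have h : ((e𝓞.symm (θ σ) : (padicCoeffIntegers S₀)ˣ) : padicCoeffIntegers S₀) = entry S₀ θ σ := by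
    have h1 := FramedRep.unitsContinuousMulEquivOfUnique_apply_coe (m := Fin 1) (A := ↥(padicCoeffIntegers S₀)) (e𝓞.symm (θ σ)) 0 0
    rw [ContinuousMulEquiv.apply_symm_apply] at h1
    rw [← h1]
    rfl
  change (((padicCoeffIntegers S₀).subtype) ((e𝓞.symm (θ σ) : (padicCoeffIntegers S₀)ˣ) :
    padicCoeffIntegers S₀)) = _
  rw [h]
  rfl

/-- The product of two `𝓞`-valued rank-one framed characters, as an `𝓞`-valued rank-one framed
character with entry the product of the entries. Existence form (no definition). [folklore] -/
theorem exists_framed_entry_mul (θ₁ θ₂ : FramedGaloisRep K (padicCoeffIntegers S₀) 1) :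
    ∃ θ : FramedGaloisRep K (padicCoeffIntegers S₀) 1, ∀ σ : absoluteGaloisGroup K,
      entry S₀ θ σ = entry S₀ θ₁ σ * entry S₀ θ₂ σ := by
  let e𝓞 := FramedRep.unitsContinuousMulEquivOfUnique (Fin 1) (padicCoeffIntegers S₀)
  let u₁ : absoluteGaloisGroup K →ₜ* (padicCoeffIntegers S₀)ˣ :=
    (e𝓞.symm : GL (Fin 1) (padicCoeffIntegers S₀) →ₜ* (padicCoeffIntegers S₀)ˣ).comp θ₁
  let u₂ : absoluteGaloisGroup K →ₜ* (padicCoeffIntegers S₀)ˣ :=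
    (e𝓞.symm : GL (Fin 1) (padicCoeffIntegers S₀) →ₜ* (padicCoeffIntegers S₀)ˣ).comp θ₂
  refine ⟨(e𝓞 : (padicCoeffIntegers S₀)ˣ →ₜ* GL (Fin 1) (padicCoeffIntegers S₀)).comp (u₁ * u₂),
    fun σ ↦ ?_⟩
  have h₁ : ((u₁ σ : (padicCoeffIntegers S₀)ˣ) : padicCoeffIntegers S₀) = entry S₀ θ₁ σ := by
    have h1 := FramedRep.unitsContinuousMulEquivOfUnique_apply_coe (m := Fin 1) (A := ↥(padicCoeffIntegers S₀)) (e𝓞.symm (θ₁ σ)) 0 0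
    rw [ContinuousMulEquiv.apply_symm_apply] at h1
    change ((e𝓞.symm (θ₁ σ) : (padicCoeffIntegers S₀)ˣ) : padicCoeffIntegers S₀) = _
    rw [← h1]
    rfl
  have h₂ : ((u₂ σ : (padicCoeffIntegers S₀)ˣ) : padicCoeffIntegers S₀) = entry S₀ θ₂ σ := by
    have h1 := FramedRep.unitsContinuousMulEquivOfUnique_apply_coe (m := Fin 1) (A := ↥(padicCoeffIntegers S₀)) (e𝓞.symm (θ₂ σ)) 0 0
    rw [ContinuousMulEquiv.apply_symm_apply] at h1
    change ((e𝓞.symm (θ₂ σ) : (padicCoeffIntegers S₀)ˣ) : padicCoeffIntegers S₀) = _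
    rw [← h1]
    rfl
  have hmul : (u₁ * u₂) σ = u₁ σ * u₂ σ := rfl
  rw [← h₁, ← h₂, ← Units.val_mul, ← hmul]
  change ((e𝓞 ((u₁ * u₂) σ) : GL (Fin 1) (padicCoeffIntegers S₀)) :
    Matrix (Fin 1) (Fin 1) (padicCoeffIntegers S₀)) 0 0 = _
  exact FramedRep.unitsContinuousMulEquivOfUnique_apply_coe (m := Fin 1) (A := ↥(padicCoeffIntegers S₀))
    ((u₁ * u₂) σ) 0 0

variable {S₀}

/-- The Frobenius polynomial of an UNRAMIFIED rank-one `θ` at `w` is `X − θ(Φ)₀₀` for any arithmetic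
Frobenius `Φ` above `w` (Serre 1968 Ch. I §2.1: `P_{v,ρ}` depends only on `v`). [cite: SerreAbelianLadic1968, Ch. I §2.1] -/
theorem hasFrobCharpolyAt_entry_of_isUnramifiedAt [NumberField K]
    {θ : FramedGaloisRep K (padicCoeffIntegers S₀) 1} {w : HeightOneSpectrum (𝓞 K)}
    (hw : θ.IsUnramifiedAt w) {𝔓 : Ideal (absIntegers (𝓞 K) K)} (h𝔓 : 𝔓 ∈ w.primesAbove)
    {Φ : absoluteGaloisGroup K} (hΦ : IsArithFrobAt (𝓞 K) Φ 𝔓) :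
    θ.HasFrobCharpolyAt w (X - C (entry S₀ θ Φ)) := by
  have hQ : θ.HasFrobCharpolyAt w (θ.toGaloisRep Φ).charpoly :=
    (FramedGaloisRep.hasFrobCharpolyAt_toGaloisRep_iff w _ θ).mp
      (((FramedGaloisRep.isUnramifiedAt_toGaloisRep_iff w θ).mpr hw).hasFrobCharpolyAt_charpoly h𝔓 hΦ)
  have h : θ.HasFrobCharpolyAt w (FramedRep.charpoly θ Φ) := by rw [hQ 𝔓 h𝔓 Φ hΦ]; exact hQ
  rwa [FramedGaloisRep.charpoly_eq_of_rank_one] at h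

end Plumbing

/-! ## §2 Avatars: `θ_K ↦ θ⁻¹` for `θ` unramified away from `p`; `‖·‖ ↦ χ_p` -/

section Avatars

variable {K : Type} [Field K] [NumberField K] {p : ℕ} [Fact p.Prime] {S₀ : Set (PadicAlgCl p)}

/-- **The geometric avatar of the arithmetic Hecke character of `θ` is `θ⁻¹`, when `θ` is unramified
at every `w ∤ p`.** With `IsHeckeCharOf ι θ θ_K` (`θ_K(ϖ_w) = ι(θ(Frob_w^{arith}))` wherever `θ` is
unramified) and `ψ(σ) = θ(σ)₀₀`: `IsPAdicAvatarOf ι θ_K (e ∘ ψ⁻¹)` — at every `w ∤ p`, `θ` (hence `ψ⁻¹`)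
is unramified and `ψ⁻¹(Frob_w) = θ(Frob_w)⁻¹ = ι⁻¹(θ_K(ϖ_w))⁻¹`, the GEOMETRIC normalisation of the
tree's avatars (docstring of `IsHeckeCharOf`: "the avatar of this `θ_K` is `θ⁻¹`"). The hypothesis
"unramified away from `p`" is what makes the two one-sided predicates meet (it holds for `ω|_K`).
[cite: CastellaHsieh2018, §3.3 (p. 9)] [cite: SerreAbelianLadic1968, Ch. I §2.1, Ch. II §2.7] -/
theorem isPAdicAvatarOf_inv_of_isHeckeCharOf (ι : PadicAlgCl p ≃+* ℂ)
    {θ : FramedGaloisRep K (padicCoeffIntegers S₀) 1} {θK : HeckeCharacter K} (hθK : IsHeckeCharOf ι θ θK)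
    (hunr : ∀ w : HeightOneSpectrum (𝓞 K), ((p : ℕ) : 𝓞 K) ∉ w.asIdeal → θ.IsUnramifiedAt w)
    {ψ : absoluteGaloisGroup K →ₜ* (PadicAlgCl p)ˣ}
    (hψ : ∀ σ : absoluteGaloisGroup K,
      ((ψ σ : (PadicAlgCl p)ˣ) : PadicAlgCl p) = ((entry S₀ θ σ : padicCoeffIntegers S₀) : PadicAlgCl p)) :
    IsPAdicAvatarOf ι θK ((FramedRep.unitsContinuousMulEquivOfUnique (Fin 1) (PadicAlgCl p) :
      (PadicAlgCl p)ˣ →ₜ* GL (Fin 1) (PadicAlgCl p)).comp ψ⁻¹) := by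
  rw [isPAdicAvatarOf_unitsChar_iff]
  intro w hpw _
  have hw := hunr w hpw
  refine ⟨fun 𝔓 h𝔓 σ hσ ↦ ?_, fun 𝔓 h𝔓 Φ hΦ ↦ ?_⟩
  · -- inertia: `θ σ = 1`, so `ψ σ = 1`
    have h1 : θ σ = 1 := hw 𝔓 h𝔓 σ hσ
    have h2 : ψ σ = 1 := by
      apply Units.ext
      rw [hψ σ, entry_eq_one_of_apply_eq_one S₀ θ h1, Units.val_one, OneMemClass.coe_one]
    rw [unitsChar_inv_apply, h2, inv_one]
  · -- Frobenius: `θ_K(ϖ_w) = ι(θ(Φ)₀₀)`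
    have hval := (hθK w hw).2 (entry S₀ θ Φ) (hasFrobCharpolyAt_entry_of_isUnramifiedAt hw h𝔓 hΦ)
    rw [unitsChar_inv_apply, Units.val_inv_eq_inv_val, hψ Φ, hval, RingEquiv.symm_apply_apply]

/-- A continuous character `Γ_K →ₜ* ℚ̄_pˣ` with values `χ_p(σ)` (the `p`-adic cyclotomic character read
in `ℚ̄_p`) exists. Existence form (no definition). [cite: SerreAbelianLadic1968, Ch. I §1.2] -/
theorem exists_unitsCharCl_cyclotomic (K : Type) [Field K] (p : ℕ) [Fact p.Prime] :
    ∃ χ : absoluteGaloisGroup K →ₜ* (PadicAlgCl p)ˣ, ∀ σ : absoluteGaloisGroup K,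
      ((χ σ : (PadicAlgCl p)ˣ) : PadicAlgCl p) =
        algebraMap ℚ_[p] (PadicAlgCl p) (((GaloisRep.cyclotomicCharacter K p σ : ℤ_[p]ˣ) : ℤ_[p]) : ℚ_[p]) := by
  let j : ℤ_[p] →+* PadicAlgCl p := (algebraMap ℚ_[p] (PadicAlgCl p)).comp PadicInt.Coe.ringHom
  have hjc : Continuous j := (continuous_algebraMap ℚ_[p] (PadicAlgCl p)).comp continuous_subtype_val
  let f : absoluteGaloisGroup K →* (PadicAlgCl p)ˣ :=
    (Units.map j.toMonoidHom).comp (GaloisRep.cyclotomicCharacter K p).toMonoidHom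
  have hfc : Continuous f := (Continuous.units_map _ hjc).comp (GaloisRep.cyclotomicCharacter K p).continuous
  exact ⟨{ toMonoidHom := f, continuous_toFun := hfc }, fun σ ↦ rfl⟩

/-- **The avatar of the norm character `‖·‖` is the cyclotomic character** (`χ_p(Frob_w) = Nw`,
`‖ϖ_w‖ = Nw⁻¹`; tree `FramedGaloisRep.hasFrobCharpolyAt_normCharacter_of_cyclotomic`).
[cite: SerreAbelianLadic1968, Ch. I §1.2 (Example: the cyclotomic character)] -/
theorem isPAdicAvatarOf_normCharacter (ι : PadicAlgCl p ≃+* ℂ)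
    {χ : absoluteGaloisGroup K →ₜ* (PadicAlgCl p)ˣ}
    (hχ : ∀ σ : absoluteGaloisGroup K, ((χ σ : (PadicAlgCl p)ˣ) : PadicAlgCl p) =
      algebraMap ℚ_[p] (PadicAlgCl p) (((GaloisRep.cyclotomicCharacter K p σ : ℤ_[p]ˣ) : ℤ_[p]) : ℚ_[p])) :
    IsPAdicAvatarOf ι (normCharacter K) ((FramedRep.unitsContinuousMulEquivOfUnique (Fin 1) (PadicAlgCl p) :
      (PadicAlgCl p)ˣ →ₜ* GL (Fin 1) (PadicAlgCl p)).comp χ) := by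
  intro w hpw _
  have hentry : ∀ σ : absoluteGaloisGroup K,
      ((((FramedRep.unitsContinuousMulEquivOfUnique (Fin 1) (PadicAlgCl p) :
        (PadicAlgCl p)ˣ →ₜ* GL (Fin 1) (PadicAlgCl p)).comp χ σ : GL (Fin 1) (PadicAlgCl p)) :
          Matrix (Fin 1) (Fin 1) (PadicAlgCl p)) 0 0) =
        algebraMap ℚ_[p] (PadicAlgCl p)
          (((GaloisRep.cyclotomicCharacter K p σ : ℤ_[p]ˣ) : ℤ_[p]) : ℚ_[p]) := fun σ ↦ by
    rw [unitsChar_apply_coe, hχ σ]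
  obtain ⟨h1, h2⟩ := FramedGaloisRep.hasFrobCharpolyAt_normCharacter_of_cyclotomic
    ((FramedRep.unitsContinuousMulEquivOfUnique (Fin 1) (PadicAlgCl p) :
      (PadicAlgCl p)ˣ →ₜ* GL (Fin 1) (PadicAlgCl p)).comp χ) hentry ι hpw
  rw [map_inv₀] at h2
  exact ⟨h1, h2⟩

end Avatars

/-! ## §3 The determinant identity over `K` and the unramifiedness of `ω|_K` away from `p` -/

section DetK

variable {K : Type} [Field K] [NumberField K] {p : ℕ} [hp : Fact p.Prime] {S₀ : Set (PadicAlgCl p)}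

/-- **(K-det) restricted to `Γ_K`, in `χ_p`-currency**: if `θ_sub(τ)θ_quot(τ) = ω(χ̄_p(τ))` on `Γ_ℚ`
then for `σ ∈ Γ_K`, `θ_sub|_K(σ) θ_quot|_K(σ) = ω(χ_p(σ) mod p)` with `χ_p` the `p`-ADIC cyclotomic
character of `K` (`χ̄_p = χ_p mod p`, `toZMod_cyclotomicCharacter_apply`; compatibility of `χ_p` with
restriction, `cyclotomicCharacter_absGaloisRestrict`). [cite: SerreAbelianLadic1968, Ch. I §1.2]
[cite: KellerYin2024, §1.1 (arXiv:2402.12781v2 TeX L441–L450: "φψ = ω")] -/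
theorem entry_restrictField_mul_eq (θsub θquot : FramedGaloisRep ℚ (padicCoeffIntegers S₀) 1)
    (hdet : ∀ τ : absoluteGaloisGroup ℚ,
      ((entry S₀ θsub τ : padicCoeffIntegers S₀) : PadicAlgCl p) *
          ((entry S₀ θquot τ : padicCoeffIntegers S₀) : PadicAlgCl p) =
        algebraMap ℚ_[p] (PadicAlgCl p)
          (((Kato2004.teichmullerChar p (modPCyclotomicCharacterZMod ℚ p τ) : ℤ_[p]ˣ) : ℤ_[p]) : ℚ_[p]))
    (σ : absoluteGaloisGroup K) :
    ((entry S₀ (θsub.restrictField K) σ : padicCoeffIntegers S₀) : PadicAlgCl p) *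
        ((entry S₀ (θquot.restrictField K) σ : padicCoeffIntegers S₀) : PadicAlgCl p) =
      algebraMap ℚ_[p] (PadicAlgCl p)
        (((Kato2004.teichmullerChar p (Units.map (PadicInt.toZMod (p := p)).toMonoidHom
          (GaloisRep.cyclotomicCharacter K p σ)) : ℤ_[p]ˣ) : ℤ_[p]) : ℚ_[p]) := by
  have h := hdet (absGaloisRestrict ℚ K σ)
  have hmod : modPCyclotomicCharacterZMod ℚ p (absGaloisRestrict ℚ K σ) =
      Units.map (PadicInt.toZMod (p := p)).toMonoidHom (GaloisRep.cyclotomicCharacter K p σ) := by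
    apply Units.ext
    rw [← toZMod_cyclotomicCharacter_apply, cyclotomicCharacter_absGaloisRestrict ℚ K p σ]
    rfl
  rw [hmod] at h
  exact h

/-- **A character of `Γ_K` whose entry is `ω(χ_p mod p)` is UNRAMIFIED AT EVERY `w ∤ p`** (the
cyclotomic character is: `FramedGaloisRep.isUnramifiedAt_cyclotomic_holds`).
[cite: SerreAbelianLadic1968, Ch. I §1.2 (Example: the cyclotomic character)] -/
theorem isUnramifiedAt_of_entry_eq_teichmullerChar {θ : FramedGaloisRep K (padicCoeffIntegers S₀) 1}
    (hθ : ∀ σ : absoluteGaloisGroup K, ((entry S₀ θ σ : padicCoeffIntegers S₀) : PadicAlgCl p) =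
      algebraMap ℚ_[p] (PadicAlgCl p)
        (((Kato2004.teichmullerChar p (Units.map (PadicInt.toZMod (p := p)).toMonoidHom
          (GaloisRep.cyclotomicCharacter K p σ)) : ℤ_[p]ˣ) : ℤ_[p]) : ℚ_[p]))
    {w : HeightOneSpectrum (𝓞 K)} (hw : ((p : ℕ) : 𝓞 K) ∉ w.asIdeal) : θ.IsUnramifiedAt w := by
  intro 𝔓 h𝔓 σ hσ
  have h1 : FramedGaloisRep.cyclotomic K p σ = 1 :=
    FramedGaloisRep.isUnramifiedAt_cyclotomic_holds K p hw 𝔓 h𝔓 σ hσ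
  have h2 : GaloisRep.cyclotomicCharacter K p σ = 1 := by
    have h : ((GaloisRep.cyclotomicCharacter K p σ : ℤ_[p]ˣ) : ℤ_[p]) = 1 := by
      have := congrArg (fun g : GL (Fin 1) ℤ_[p] ↦ (g : Matrix (Fin 1) (Fin 1) ℤ_[p]) 0 0) h1
      simpa [FramedGaloisRep.cyclotomic] using this
    exact Units.ext h
  apply apply_eq_one_of_entry_eq_one S₀ θ σ
  apply Subtype.ext
  rw [hθ σ, h2, map_one, map_one, Units.val_one, PadicInt.coe_one, map_one, OneMemClass.coe_one]

end DetK

/-! ## §4 The ω-branch characters `φ_K`, `η = Ω_K‖·‖` and the avatar `⟨χ_p⟩` of `η` -/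

section Omega

/-- Powers of a `1 × 1` matrix: `(M^k)₀₀ = (M₀₀)^k`. [folklore] -/
theorem matrix_fin_one_pow_apply' {R : Type*} [CommRing R] (M : Matrix (Fin 1) (Fin 1) R) (k : ℕ) :
    (M ^ k) 0 0 = M 0 0 ^ k := by
  induction k with | zero => simp | succ k ih => simp [pow_succ, Matrix.mul_apply, ih]

variable {K : Type} [Field K] [NumberField K] [IsCMField K] {p : ℕ} [hp : Fact p.Prime]
  {S₀ : Set (PadicAlgCl p)}

/-- **The characters of the ω-branch.** `θ_sub, θ_quot : Γ_ℚ → GL₁(𝓞)` `(p−1)`-torsion, unramified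
almost everywhere, with `θ_sub θ_quot = ω ∘ χ̄_p` (K-det); `ψ_K` the Hecke character of `θ_quot|_K`.
Then there are Hecke characters `φ_K`, `η` of `K` and a continuous `r_η : Γ_K →ₜ* ℚ̄_pˣ` such that:
(i) `IsHeckeCharOf ι θ_sub|_K φ_K`; (ii) `φ_K⁻¹ η = (ψ_K⁻¹)̌ = ψ_K‖·‖`; (iii) `η` is unramified at every
`w ∤ p`; (iv) `e ∘ r_η` is the `p`-adic avatar of `η`; (v) `r_η(σ) = ⟨χ_p(σ)⟩ = χ_p(σ)·ω(χ_p(σ) mod p)⁻¹`;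
(vi) at `w ∤ p`, `φ_K` is unramified iff `ψ_K` is. Construction: `Ω_K` := the Artin character of
`ω|_K = (θ_subθ_quot)|_K` (unramified away from `p`, §3), `φ_K` := the Artin character of `θ_sub|_K`,
`η := Ω_K‖·‖`, `r_η := (ω|_K)⁻¹ · χ_p`; the identity `φ_K ψ_K = Ω_K` is Hecke rigidity (both sides are
`ι(θ_sub(Frob_w)θ_quot(Frob_w))` at a.e. `w`); (ii) then reads `φ_K⁻¹Ω_K‖·‖ = ψ_K‖·‖ = (ψ_K⁻¹)̌ ` since
`ψ_K ∘ c = ψ_K` (base change from `ℚ`). This is BR-OMEGA-ROAD §2 (a)–(c) in the tree's currency.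
[cite: deShalit1987, II.6.1 (1) (store chunk 81)] [cite: CastellaGrossiLeeSkinner2022, proof of Thm. 2.2.2, (2.16) ("ψ = φ⁻¹ω")]
[cite: CasselsFrohlichANT1967, Ch. VII §4 Prop. 4.1 and §5.1 Main Theorem (A)]
[cite: KellerYin2024, §1.1 (arXiv:2402.12781v2 TeX L441–L450) and Thm. 1.2.2 (L676–683)] -/
theorem exists_omegaBranchCharacters (ι : PadicAlgCl p ≃+* ℂ)
    {θsub θquot : FramedGaloisRep ℚ (padicCoeffIntegers S₀) 1}
    (hTsub : ∀ τ : absoluteGaloisGroup ℚ, θsub τ ^ (p - 1) = 1)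
    (hTquot : ∀ τ : absoluteGaloisGroup ℚ, θquot τ ^ (p - 1) = 1)
    (hev_sub : ∀ᶠ u : HeightOneSpectrum (𝓞 ℚ) in cofinite, θsub.IsUnramifiedAt u)
    (hev_quot : ∀ᶠ u : HeightOneSpectrum (𝓞 ℚ) in cofinite, θquot.IsUnramifiedAt u)
    (hdet : ∀ τ : absoluteGaloisGroup ℚ,
      ((entry S₀ θsub τ : padicCoeffIntegers S₀) : PadicAlgCl p) *
          ((entry S₀ θquot τ : padicCoeffIntegers S₀) : PadicAlgCl p) =
        algebraMap ℚ_[p] (PadicAlgCl p)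
          (((Kato2004.teichmullerChar p (modPCyclotomicCharacterZMod ℚ p τ) : ℤ_[p]ˣ) : ℤ_[p]) : ℚ_[p]))
    {ψK : HeckeCharacter K} (hψK : IsHeckeCharOf ι (θquot.restrictField K) ψK) :
    ∃ (φK η : HeckeCharacter K) (rη : absoluteGaloisGroup K →ₜ* (PadicAlgCl p)ˣ),
      IsHeckeCharOf ι (θsub.restrictField K) φK ∧
      φK.IsFiniteOrder ∧
      φK⁻¹ * η = DeShalit1987.reflect ψK⁻¹ ∧
      (∀ w : HeightOneSpectrum (𝓞 K), ((p : ℕ) : 𝓞 K) ∉ w.asIdeal → η.IsUnramifiedAt w) ∧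
      IsPAdicAvatarOf ι η ((FramedRep.unitsContinuousMulEquivOfUnique (Fin 1) (PadicAlgCl p) :
        (PadicAlgCl p)ˣ →ₜ* GL (Fin 1) (PadicAlgCl p)).comp rη) ∧
      (∀ σ : absoluteGaloisGroup K, ((rη σ : (PadicAlgCl p)ˣ) : PadicAlgCl p) =
        algebraMap ℚ_[p] (PadicAlgCl p)
          (((GaloisRep.cyclotomicCharacter K p σ /
              Kato2004.teichmullerChar p
                (Units.map (PadicInt.toZMod (p := p)).toMonoidHom (GaloisRep.cyclotomicCharacter K p σ)) :
              ℤ_[p]ˣ) : ℤ_[p]) : ℚ_[p])) ∧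
      (∀ w : HeightOneSpectrum (𝓞 K), ((p : ℕ) : 𝓞 K) ∉ w.asIdeal →
        (φK.IsUnramifiedAt w ↔ ψK.IsUnramifiedAt w)) := by
  -- §a: the product `ω|_K = θ_sub|_K · θ_quot|_K`, `(p−1)`-torsion, entry `ω(χ_p mod p)`, unramified off `p`
  obtain ⟨θω, hω⟩ := exists_framed_entry_mul S₀ (θsub.restrictField K) (θquot.restrictField K)
  have hωentry : ∀ σ : absoluteGaloisGroup K, ((entry S₀ θω σ : padicCoeffIntegers S₀) : PadicAlgCl p) =
      algebraMap ℚ_[p] (PadicAlgCl p)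
        (((Kato2004.teichmullerChar p (Units.map (PadicInt.toZMod (p := p)).toMonoidHom
          (GaloisRep.cyclotomicCharacter K p σ)) : ℤ_[p]ˣ) : ℤ_[p]) : ℚ_[p]) := fun σ ↦ by
    rw [hω σ, Subring.coe_mul]
    exact entry_restrictField_mul_eq θsub θquot hdet σ
  have hωunr : ∀ w : HeightOneSpectrum (𝓞 K), ((p : ℕ) : 𝓞 K) ∉ w.asIdeal → θω.IsUnramifiedAt w :=
    fun w hw ↦ isUnramifiedAt_of_entry_eq_teichmullerChar hωentry hw
  have hTω : ∀ σ : absoluteGaloisGroup K, θω σ ^ (p - 1) = 1 := by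
    intro σ
    have hT1 : entry S₀ (θsub.restrictField K) σ ^ (p - 1) = 1 :=
      entry_pow_eq_one_of_pow_eq_one S₀ _ σ (by rw [FramedGaloisRep.restrictField_apply]; exact hTsub _)
    have hT2 : entry S₀ (θquot.restrictField K) σ ^ (p - 1) = 1 :=
      entry_pow_eq_one_of_pow_eq_one S₀ _ σ (by rw [FramedGaloisRep.restrictField_apply]; exact hTquot _)
    have he : entry S₀ θω σ ^ (p - 1) = 1 := by rw [hω σ, mul_pow, hT1, hT2, one_mul]
    refine FramedGaloisRep.gl_one_eq_one_of_apply_eq_one ?_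
    rw [Units.val_pow_eq_pow_val, matrix_fin_one_pow_apply']
    exact he
  -- §b: the Artin characters `Ω_K` of `ω|_K` and `φ_K` of `θ_sub|_K`
  obtain ⟨ΩK, -, hΩK'⟩ := exists_heckeCharacter_of_pow_eq_one S₀ ι θω hTω
  have hΩK : IsHeckeCharOf ι θω ΩK := hΩK'
  have hTsubK : ∀ σ : absoluteGaloisGroup K, θsub.restrictField K σ ^ (p - 1) = 1 := fun σ ↦ by
    rw [FramedGaloisRep.restrictField_apply]; exact hTsub _
  obtain ⟨φK, hφfin, hφK'⟩ := exists_heckeCharacter_of_pow_eq_one S₀ ι (θsub.restrictField K) hTsubK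
  have hφK : IsHeckeCharOf ι (θsub.restrictField K) φK := hφK'
  -- §c: `φ_K ψ_K = Ω_K` by Hecke rigidity
  have hprod : φK * ψK = ΩK := by
    apply HeckeCharacter.ext_of_eventually_valueAtUniformizer_eq
    filter_upwards [eventually_isUnramifiedAt_restrictField_rat (K := K) θsub hev_sub,
      eventually_isUnramifiedAt_restrictField_rat (K := K) θquot hev_quot,
      FramedGaloisRep.eventually_natCast_not_mem K p] with w hwsub hwquot hwp
    obtain ⟨𝔓, h𝔓⟩ := w.primesAbove_nonempty
    obtain ⟨Φ, hΦ⟩ := HeightOneSpectrum.exists_isArithFrobAt_of_mem_primesAbove_holds h𝔓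
    have h1 := (hφK w hwsub).2 _ (hasFrobCharpolyAt_entry_of_isUnramifiedAt hwsub h𝔓 hΦ)
    have h2 := (hψK w hwquot).2 _ (hasFrobCharpolyAt_entry_of_isUnramifiedAt hwquot h𝔓 hΦ)
    have h3 := (hΩK w (hωunr w hwp)).2 _ (hasFrobCharpolyAt_entry_of_isUnramifiedAt (hωunr w hwp) h𝔓 hΦ)
    rw [HeckeCharacter.valueAtUniformizer_mul', h1, h2, h3, hω Φ, Subring.coe_mul, map_mul]
  -- §d: `c`-invariance of `ψ_K` and the reflected character
  have hgal : HeckeCharacter.galConj (IsCMField.complexConj K) ψK = ψK :=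
    hψK.galConj_eq_of_restrictField ι hev_quot _
  have hrefl : DeShalit1987.reflect ψK⁻¹ = ψK * normCharacter K := DeShalit1987.reflect_inv_of_galConj_eq hgal
  -- §e: the avatar of `η = Ω_K‖·‖`
  obtain ⟨ψω, hψω⟩ := exists_unitsCharCl_entry S₀ θω
  obtain ⟨χ, hχ⟩ := exists_unitsCharCl_cyclotomic K p
  have havΩ := isPAdicAvatarOf_inv_of_isHeckeCharOf ι hΩK hωunr hψω
  have havN := isPAdicAvatarOf_normCharacter (K := K) ι hχ
  have hΩunr : ∀ w : HeightOneSpectrum (𝓞 K), ((p : ℕ) : 𝓞 K) ∉ w.asIdeal → ΩK.IsUnramifiedAt w :=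
    fun w hw ↦ (hΩK w (hωunr w hw)).1
  have havη : IsPAdicAvatarOf ι (ΩK * normCharacter K)
      ((FramedRep.unitsContinuousMulEquivOfUnique (Fin 1) (PadicAlgCl p) :
        (PadicAlgCl p)ˣ →ₜ* GL (Fin 1) (PadicAlgCl p)).comp (ψω⁻¹ * χ)) :=
    isPAdicAvatarOf_mul ι havΩ havN (hram_of_forall hΩunr (fun w _ ↦ isUnramifiedAt_normCharacter' w))
  refine ⟨φK, ΩK * normCharacter K, ψω⁻¹ * χ, hφK, hφfin, ?_, ?_, havη, fun σ ↦ ?_, fun w hw ↦ ?_⟩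
  · -- (ii) `φ_K⁻¹ (Ω_K‖·‖) = ψ_K‖·‖ = reflect ψ_K⁻¹`
    rw [hrefl, ← hprod, ← mul_assoc, ← mul_assoc, inv_mul_cancel, one_mul]
  · -- (iii) unramified away from `p`
    exact fun w hw ↦ (hΩunr w hw).mul' (isUnramifiedAt_normCharacter' w)
  · -- (v) the formula `r_η(σ) = χ_p(σ) · ω(χ_p(σ) mod p)⁻¹`
    set t : ℤ_[p]ˣ := Kato2004.teichmullerChar p
      (Units.map (PadicInt.toZMod (p := p)).toMonoidHom (GaloisRep.cyclotomicCharacter K p σ)) with ht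
    have hωσ : ((ψω σ : (PadicAlgCl p)ˣ) : PadicAlgCl p) =
        algebraMap ℚ_[p] (PadicAlgCl p) (((t : ℤ_[p]ˣ) : ℤ_[p]) : ℚ_[p]) := by rw [hψω σ, hωentry σ]
    have hωinv : (((ψω⁻¹) σ : (PadicAlgCl p)ˣ) : PadicAlgCl p) =
        algebraMap ℚ_[p] (PadicAlgCl p) (((t⁻¹ : ℤ_[p]ˣ) : ℤ_[p]) : ℚ_[p]) := by
      rw [unitsChar_inv_apply, Units.val_inv_eq_inv_val, hωσ]
      symm
      apply eq_inv_of_mul_eq_one_left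
      rw [← map_mul, ← PadicInt.coe_mul, ← Units.val_mul, inv_mul_cancel, Units.val_one, PadicInt.coe_one,
        map_one]
    rw [ContinuousMonoidHom.mul_apply, Units.val_mul, hωinv, hχ σ, ← map_mul, ← PadicInt.coe_mul,
      div_eq_mul_inv, Units.val_mul, mul_comm]
  · -- (vi) ramification of `φ_K = Ω_K ψ_K⁻¹` at `w ∤ p`
    have hφ : φK = ΩK * ψK⁻¹ := by rw [← hprod, mul_inv_cancel_right]
    constructor
    · intro h
      have h' := ((hΩunr w hw).inv'.mul' h)
      rwa [hφ, ← mul_assoc, inv_mul_cancel, one_mul, HeckeCharacter.isUnramifiedAt_inv_iff] at h'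
    · intro h
      rw [hφ]
      exact (hΩunr w hw).mul' h.inv'

end Omega

end Summit.BirchSwinnertonDyer.BirchSwinnertonDyer.Theorems.IwasawaTwoVariable

end
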